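import Summits.NavierStokesRegularity.NavierStokesRegularity.Theorems.TaoLadderRungTwoFlatNearHop
import Summits.NavierStokesRegularity.NavierStokesRegularity.Theorems.TaoLadderRungTwoFlatCoMovingEnergyEdge
import HarnessLib

/-!
# The NEAR-ZONE HOP, part 2 — the START of the hop: the initial block energy from the clauses of `H(n)` and the kick
  (helper for the K_A♭ parent item stmt-NavierStokesRegularity-22987, child 2A `GradedAdiabaticWakeA` of route
  TaoLadderRungTwoFlat; cell harvest/h2-tao-ladder, p1 g22; companion of `…Theorems.TaoLadderRungTwoFlatNearHop`)

`…NearHop.near_hop_of_pseudoFlows` / `near_hop_of_globalSols` take an initial bound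
`V_{[1−D,−K]}^{−K}(S − W)(0) ≤ V₀`. Here `V₀` is made a SCHEDULE expression:

* `sqrt_initial_coMovingEnergyOn_le` — `√V(0) ≤ √v(n) + δ(n)/ω_K + √D·r_k + √E_W` from `NearClause n z` (the block
  shells `[1−D, −K−1]`), the core clause of `H(n)` at the one block shell `−K` it does not cover (gauge floor
  `ω_K ≤ ω_i(−K)`), the kick `|S₀ − z| ≤ r_k` on the block (weights `≤ 1` behind the window bottom) and the reference
  start residual `E_W` (zero when the reference flow starts at the scaled section state `x(z)·u⋆`). These are the
  `m₁₁` / `m₁₂` entries of the two-zone loop (`TwoZoneLoop`) in amplitude variables.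

* `sqrt_initial_coMovingEnergyOn_le_additive` — the same with the core deposit ENERGY-additive (`√(v(n) + (δ(n)/ω_K)²)`),
  the form to compose into the schedule (cf. theory-1 TRAP #11 / L-55a);
* `near_hop_of_pseudoFlows_amp` — the EDGE INPUT discharged by amplitudes (tree `MirrorPulse.edgeInput_le`, E1/E2 of
  LADDER §49.3): with the a-priori bound `A` of the hop theorem, the template bound `M ≥ 0` and the CORE deviation
  `|(S − W)_{0,1−K}| ≤ r ≤ A` just above the block during the hop, the edge-input hypothesis `hE` holds with
  `Ē := e^{θ_V(1−D+K)}(1+ε)A²(A+M) + (1+ε)r(A² + Mr)` (bottom input damped by the block depth, top input first order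
  in the core deviation — the `core → near` entry `m₁₂`); so `TubeStepNear n` needs only `A`, `M`, `r`, `V₀`, `R_T`.

HONEST FRAMING: inequalities about MODEL-lattice states (Tao 2016 §4 vocabulary, graded mirror table on `S♭`); every
bound is a HYPOTHESIS; nothing certified; no item closed; nothing about the Navier–Stokes equations.
-/

noncomputable section

-- the sub-problem namespace repeats the summit name by design (D-0017)
set_option linter.dupNamespace false

namespace Summit.NavierStokesRegularity.NavierStokesRegularity.Theorems.HopTube

open Set Finset Literature.Analysis.FluidPDE Literature.Analysis.FluidPDE.TaoCascade MirrorPulse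

/-! ## The start: the initial block energy from the clauses of `H(n)` and the kick -/

section Start

variable (P : TubeSchedule) {i₀ : Fin 2} {ustar z S₀ W₀ : Fin 2 → ℤ → ℝ} {S W : Fin 2 → ℤ → ℝ → ℝ}

/-- **THE INITIAL BLOCK ENERGY.** At the start of hop `n` the co-moving deviation energy of `S − W` on the landing
block `[1−D, −K]` (edge `−K`) is controlled in amplitude by the clauses of `H(n)` for the tube state `z`, the kick
`|S₀ − z| ≤ r_k` and the reference start residual: `√V(0) ≤ √v(n) + δ(n)/ω_K + √D·r_k + √E_W`, where `ω_K > 0` is a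
floor of the core gauge at the window bottom `−K` (the core clause controls the one block shell `−K` that the near
clause of `H(n)` does not) and `E_W` bounds the weighted block energy of `x(z)·u⋆ − W₀` (zero when the reference flow
starts at the scaled section state). [cite: Tao2016AveragedNS, §6.3–6.4 (statement shape); route TaoLadderRungTwoFlat, `HopTube.TubeStepNear` entries `m₁₁`, `m₁₂` of the two-zone loop (LADDER §49.5)] -/
theorem sqrt_initial_coMovingEnergyOn_le {n : ℕ} {ωK rk EW : ℝ}
    (hS0 : ∀ i k, S i k 0 = S₀ i k) (hW0 : ∀ i k, W i k 0 = W₀ i k)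
    (hθ : 0 ≤ P.θV) (hDK : P.K + 1 ≤ P.D)
    (hnear : NearClause P i₀ ustar n z) (hcore : CoreClause P i₀ ustar n z)
    (hωK : 0 < ωK) (hωKle : ∀ i, ωK ≤ MirrorPulse.geomGauge P.g P.b i (-(P.K : ℤ)))
    (hkick : ∀ i, ∀ k ∈ Finset.Icc (1 - (P.D : ℤ)) (-(P.K : ℤ)), |S₀ i k - z i k| ≤ rk) (hrk : 0 ≤ rk)
    (hEW : coMovingEnergyOn (Finset.Icc (1 - (P.D : ℤ)) (-(P.K : ℤ))) P.θV (-(P.K : ℝ))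
        (fun i k _ => anchorScale P i₀ z * ustar i k - W₀ i k) 0 ≤ EW) :
    Real.sqrt (coMovingEnergyOn (Finset.Icc (1 - (P.D : ℤ)) (-(P.K : ℤ))) P.θV (-(P.K : ℝ)) (S - W) 0)
      ≤ Real.sqrt (P.v n) + P.δ n / ωK + Real.sqrt P.D * rk + Real.sqrt EW := by
  have haP : (1 - (P.D : ℤ)) ≤ -(P.K : ℤ) := by
    have : ((P.K + 1 : ℕ) : ℤ) ≤ (P.D : ℤ) := by exact_mod_cast hDK
    push_cast at this; omega
  -- `√(x + y) ≤ √x + √y` (inlined; the tree's copy lives in an unrelated Literature module)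
  have hsqrt_add : ∀ {x y : ℝ}, 0 ≤ x → 0 ≤ y → Real.sqrt (x + y) ≤ Real.sqrt x + Real.sqrt y := by
    intro x y hx hy
    rw [Real.sqrt_le_left (by positivity)]
    nlinarith [Real.sq_sqrt hx, Real.sq_sqrt hy, Real.sqrt_nonneg x, Real.sqrt_nonneg y]
  set blk : Finset ℤ := Finset.Icc (1 - (P.D : ℤ)) (-(P.K : ℤ)) with hblk
  set x : ℝ := anchorScale P i₀ z with hx
  -- the three pieces of `S₀ − W₀`
  set u₁ : Fin 2 → ℤ → ℝ → ℝ := fun i k _ => z i k - x * ustar i k with hu₁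
  set u₂ : Fin 2 → ℤ → ℝ → ℝ := fun i k _ => S₀ i k - z i k with hu₂
  set u₃ : Fin 2 → ℤ → ℝ → ℝ := fun i k _ => x * ustar i k - W₀ i k with hu₃
  have hsplit : coMovingEnergyOn blk P.θV (-(P.K : ℝ)) (S - W) 0
      = coMovingEnergyOn blk P.θV (-(P.K : ℝ)) (u₁ + u₂ + u₃) 0 := by
    refine coMovingEnergyOn_congr_at fun i k _ => ?_
    simp only [Pi.sub_apply, Pi.add_apply, hu₁, hu₂, hu₃, hS0, hW0]
    ring
  -- piece 1: near clause of `H(n)` on `[1−D, −K−1]` plus the core clause at `−K`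
  have hωpos : ∀ i, 0 < MirrorPulse.geomGauge P.g P.b i (-(P.K : ℤ)) := fun i => lt_of_lt_of_le hωK (hωKle i)
  have hδ0 : 0 ≤ P.δ n :=
    le_trans (mul_nonneg (hωpos 0).le (abs_nonneg _)) (hcore 0 (-(P.K : ℤ)) le_rfl)
  have hdevK : ∀ i, |z i (-(P.K : ℤ)) - x * ustar i (-(P.K : ℤ))| ≤ P.δ n / ωK := by
    intro i
    have h := hcore i (-(P.K : ℤ)) le_rfl
    rw [le_div_iff₀ hωK]
    calc |z i (-(P.K : ℤ)) - x * ustar i (-(P.K : ℤ))| * ωK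
        ≤ |z i (-(P.K : ℤ)) - x * ustar i (-(P.K : ℤ))| * MirrorPulse.geomGauge P.g P.b i (-(P.K : ℤ)) :=
          mul_le_mul_of_nonneg_left (hωKle i) (abs_nonneg _)
      _ = MirrorPulse.geomGauge P.g P.b i (-(P.K : ℤ)) * |z i (-(P.K : ℤ)) - x * ustar i (-(P.K : ℤ))| :=
          mul_comm _ _
      _ ≤ P.δ n := h
  have hnear' : coMovingEnergyOn (Finset.Icc (-(P.D : ℤ)) (-(P.K : ℤ) - 1)) P.θV (-(P.K : ℝ)) u₁ 0 ≤ P.v n := by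
    rw [coMovingEnergyOn_eq_nearSum]
    simpa only [hu₁, NearClause, hx] using hnear
  have hv0 : 0 ≤ P.v n := le_trans (coMovingEnergyOn_nonneg _ _ _ _ _) hnear'
  have hE₁ : coMovingEnergyOn blk P.θV (-(P.K : ℝ)) u₁ 0 ≤ P.v n + (P.δ n / ωK) ^ 2 := by
    have hsucc := coMovingEnergyOn_Icc_succ_le (a := 1 - (P.D : ℤ)) (P := -(P.K : ℤ) - 1) (θ := P.θV)
      (ne := -(P.K : ℝ)) (by omega) hθ (by push_cast; linarith) u₁ 0
    simp only [sub_add_cancel] at hsucc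
    have hsub : Finset.Icc (1 - (P.D : ℤ)) (-(P.K : ℤ) - 1) ⊆ Finset.Icc (-(P.D : ℤ)) (-(P.K : ℤ) - 1) :=
      Finset.Icc_subset_Icc (by omega) le_rfl
    have hmono := coMovingEnergyOn_mono hsub P.θV (-(P.K : ℝ)) u₁ 0
    have hq : ∀ i, u₁ i (-(P.K : ℤ)) 0 ^ 2 ≤ (P.δ n / ωK) ^ 2 := by
      intro i
      have h := hdevK i
      simp only [hu₁]
      rw [← sq_abs]
      exact pow_le_pow_left₀ (abs_nonneg _) h 2
    have hq0 := hq 0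
    have hq1 := hq 1
    rw [hblk]
    linarith
  -- piece 2: the kick on the block (weights ≤ 1 behind the window bottom)
  have hcard : (blk.card : ℝ) ≤ P.D := by
    have h : blk.card ≤ P.D := by
      rw [hblk, Int.card_Icc]
      exact Int.toNat_le.mpr (by omega)
    exact_mod_cast h
  have hE₂ : coMovingEnergyOn blk P.θV (-(P.K : ℝ)) u₂ 0 ≤ (P.D : ℝ) * rk ^ 2 := by
    unfold coMovingEnergyOn
    calc ∑ k ∈ blk, Real.exp (P.θV * ((k : ℝ) - -(P.K : ℝ))) * ((u₂ 0 k 0 ^ 2 + u₂ 1 k 0 ^ 2) / 2)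
        ≤ ∑ k ∈ blk, rk ^ 2 := by
          refine Finset.sum_le_sum fun k hk => ?_
          have hk' : k ≤ -(P.K : ℤ) := (Finset.mem_Icc.mp (by rw [hblk] at hk; exact hk)).2
          have hkR : (k : ℝ) ≤ -(P.K : ℝ) := by exact_mod_cast hk'
          have hw : Real.exp (P.θV * ((k : ℝ) - -(P.K : ℝ))) ≤ 1 :=
            Real.exp_le_one_iff.mpr (mul_nonpos_of_nonneg_of_nonpos hθ (by linarith))
          have hs0 : ∀ i, u₂ i k 0 ^ 2 ≤ rk ^ 2 := by
            intro i
            simp only [hu₂]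
            rw [← sq_abs]
            exact pow_le_pow_left₀ (abs_nonneg _) (hkick i k (by rw [hblk] at hk; exact hk)) 2
          have hs : (u₂ 0 k 0 ^ 2 + u₂ 1 k 0 ^ 2) / 2 ≤ rk ^ 2 := by linarith [hs0 0, hs0 1]
          have hsn : 0 ≤ (u₂ 0 k 0 ^ 2 + u₂ 1 k 0 ^ 2) / 2 := by positivity
          exact (mul_le_of_le_one_left hsn hw).trans hs
      _ = blk.card * rk ^ 2 := by rw [Finset.sum_const, nsmul_eq_mul]
      _ ≤ (P.D : ℝ) * rk ^ 2 := mul_le_mul_of_nonneg_right hcard (sq_nonneg _)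
  -- piece 3: the reference start residual
  have hE₃ : coMovingEnergyOn blk P.θV (-(P.K : ℝ)) u₃ 0 ≤ EW := by
    simpa only [hu₃, hblk, hx] using hEW
  -- Minkowski twice, then the elementary square-root algebra
  have hm₁ := sqrt_coMovingEnergyOn_add_le blk P.θV (-(P.K : ℝ)) (u₁ + u₂) u₃ 0
  have hm₂ := sqrt_coMovingEnergyOn_add_le blk P.θV (-(P.K : ℝ)) u₁ u₂ 0
  have hs₁ : Real.sqrt (coMovingEnergyOn blk P.θV (-(P.K : ℝ)) u₁ 0) ≤ Real.sqrt (P.v n) + P.δ n / ωK := by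
    refine (Real.sqrt_le_sqrt hE₁).trans ?_
    refine (hsqrt_add hv0 (sq_nonneg _)).trans ?_
    rw [Real.sqrt_sq (div_nonneg hδ0 hωK.le)]
  have hs₂ : Real.sqrt (coMovingEnergyOn blk P.θV (-(P.K : ℝ)) u₂ 0) ≤ Real.sqrt P.D * rk := by
    refine (Real.sqrt_le_sqrt hE₂).trans ?_
    rw [Real.sqrt_mul (Nat.cast_nonneg _), Real.sqrt_sq hrk]
  have hs₃ : Real.sqrt (coMovingEnergyOn blk P.θV (-(P.K : ℝ)) u₃ 0) ≤ Real.sqrt EW := Real.sqrt_le_sqrt hE₃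
  rw [hsplit]
  linarith

/-- **THE INITIAL BLOCK ENERGY, ENERGY-ADDITIVE in the core deposit** (the form to compose into the near schedule; cf.
theory-1's TRAP #11 / L-55a for the behind zone): the block shell `−K` is DISJOINT from the near block of `H(n)`, so the core
clause's deposit enters the energy additively — `√V(0) ≤ √(v(n) + (δ(n)/ω_K)²) + √D·r_k + √E_W` (only the kick and the
reference start residual are added in amplitude). Same hypotheses as `sqrt_initial_coMovingEnergyOn_le`.
[cite: Tao2016AveragedNS, §6.3–6.4 (statement shape); route TaoLadderRungTwoFlat, `HopTube.TubeStepNear` schedule entries (LADDER §49.5, §55)] -/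
theorem sqrt_initial_coMovingEnergyOn_le_additive {n : ℕ} {ωK rk EW : ℝ}
    (hS0 : ∀ i k, S i k 0 = S₀ i k) (hW0 : ∀ i k, W i k 0 = W₀ i k)
    (hθ : 0 ≤ P.θV) (hDK : P.K + 1 ≤ P.D)
    (hnear : NearClause P i₀ ustar n z) (hcore : CoreClause P i₀ ustar n z)
    (hωK : 0 < ωK) (hωKle : ∀ i, ωK ≤ MirrorPulse.geomGauge P.g P.b i (-(P.K : ℤ)))
    (hkick : ∀ i, ∀ k ∈ Finset.Icc (1 - (P.D : ℤ)) (-(P.K : ℤ)), |S₀ i k - z i k| ≤ rk) (hrk : 0 ≤ rk)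
    (hEW : coMovingEnergyOn (Finset.Icc (1 - (P.D : ℤ)) (-(P.K : ℤ))) P.θV (-(P.K : ℝ))
        (fun i k _ => anchorScale P i₀ z * ustar i k - W₀ i k) 0 ≤ EW) :
    Real.sqrt (coMovingEnergyOn (Finset.Icc (1 - (P.D : ℤ)) (-(P.K : ℤ))) P.θV (-(P.K : ℝ)) (S - W) 0)
      ≤ Real.sqrt (P.v n + (P.δ n / ωK) ^ 2) + Real.sqrt P.D * rk + Real.sqrt EW := by
  have haP : (1 - (P.D : ℤ)) ≤ -(P.K : ℤ) := by
    have : ((P.K + 1 : ℕ) : ℤ) ≤ (P.D : ℤ) := by exact_mod_cast hDK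
    push_cast at this; omega
  set blk : Finset ℤ := Finset.Icc (1 - (P.D : ℤ)) (-(P.K : ℤ)) with hblk
  set x : ℝ := anchorScale P i₀ z with hx
  -- the three pieces of `S₀ − W₀`
  set u₁ : Fin 2 → ℤ → ℝ → ℝ := fun i k _ => z i k - x * ustar i k with hu₁
  set u₂ : Fin 2 → ℤ → ℝ → ℝ := fun i k _ => S₀ i k - z i k with hu₂
  set u₃ : Fin 2 → ℤ → ℝ → ℝ := fun i k _ => x * ustar i k - W₀ i k with hu₃
  have hsplit : coMovingEnergyOn blk P.θV (-(P.K : ℝ)) (S - W) 0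
      = coMovingEnergyOn blk P.θV (-(P.K : ℝ)) (u₁ + u₂ + u₃) 0 := by
    refine coMovingEnergyOn_congr_at fun i k _ => ?_
    simp only [Pi.sub_apply, Pi.add_apply, hu₁, hu₂, hu₃, hS0, hW0]
    ring
  -- piece 1: near clause of `H(n)` on `[1−D, −K−1]` plus the core clause at `−K`
  have hωpos : ∀ i, 0 < MirrorPulse.geomGauge P.g P.b i (-(P.K : ℤ)) := fun i => lt_of_lt_of_le hωK (hωKle i)
  have hδ0 : 0 ≤ P.δ n :=
    le_trans (mul_nonneg (hωpos 0).le (abs_nonneg _)) (hcore 0 (-(P.K : ℤ)) le_rfl)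
  have hdevK : ∀ i, |z i (-(P.K : ℤ)) - x * ustar i (-(P.K : ℤ))| ≤ P.δ n / ωK := by
    intro i
    have h := hcore i (-(P.K : ℤ)) le_rfl
    rw [le_div_iff₀ hωK]
    calc |z i (-(P.K : ℤ)) - x * ustar i (-(P.K : ℤ))| * ωK
        ≤ |z i (-(P.K : ℤ)) - x * ustar i (-(P.K : ℤ))| * MirrorPulse.geomGauge P.g P.b i (-(P.K : ℤ)) :=
          mul_le_mul_of_nonneg_left (hωKle i) (abs_nonneg _)
      _ = MirrorPulse.geomGauge P.g P.b i (-(P.K : ℤ)) * |z i (-(P.K : ℤ)) - x * ustar i (-(P.K : ℤ))| :=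
          mul_comm _ _
      _ ≤ P.δ n := h
  have hnear' : coMovingEnergyOn (Finset.Icc (-(P.D : ℤ)) (-(P.K : ℤ) - 1)) P.θV (-(P.K : ℝ)) u₁ 0 ≤ P.v n := by
    rw [coMovingEnergyOn_eq_nearSum]
    simpa only [hu₁, NearClause, hx] using hnear
  have hv0 : 0 ≤ P.v n := le_trans (coMovingEnergyOn_nonneg _ _ _ _ _) hnear'
  have hE₁ : coMovingEnergyOn blk P.θV (-(P.K : ℝ)) u₁ 0 ≤ P.v n + (P.δ n / ωK) ^ 2 := by
    have hsucc := coMovingEnergyOn_Icc_succ_le (a := 1 - (P.D : ℤ)) (P := -(P.K : ℤ) - 1) (θ := P.θV)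
      (ne := -(P.K : ℝ)) (by omega) hθ (by push_cast; linarith) u₁ 0
    simp only [sub_add_cancel] at hsucc
    have hsub : Finset.Icc (1 - (P.D : ℤ)) (-(P.K : ℤ) - 1) ⊆ Finset.Icc (-(P.D : ℤ)) (-(P.K : ℤ) - 1) :=
      Finset.Icc_subset_Icc (by omega) le_rfl
    have hmono := coMovingEnergyOn_mono hsub P.θV (-(P.K : ℝ)) u₁ 0
    have hq : ∀ i, u₁ i (-(P.K : ℤ)) 0 ^ 2 ≤ (P.δ n / ωK) ^ 2 := by
      intro i
      have h := hdevK i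
      simp only [hu₁]
      rw [← sq_abs]
      exact pow_le_pow_left₀ (abs_nonneg _) h 2
    have hq0 := hq 0
    have hq1 := hq 1
    rw [hblk]
    linarith
  -- piece 2: the kick on the block (weights ≤ 1 behind the window bottom)
  have hcard : (blk.card : ℝ) ≤ P.D := by
    have h : blk.card ≤ P.D := by
      rw [hblk, Int.card_Icc]
      exact Int.toNat_le.mpr (by omega)
    exact_mod_cast h
  have hE₂ : coMovingEnergyOn blk P.θV (-(P.K : ℝ)) u₂ 0 ≤ (P.D : ℝ) * rk ^ 2 := by
    unfold coMovingEnergyOn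
    calc ∑ k ∈ blk, Real.exp (P.θV * ((k : ℝ) - -(P.K : ℝ))) * ((u₂ 0 k 0 ^ 2 + u₂ 1 k 0 ^ 2) / 2)
        ≤ ∑ k ∈ blk, rk ^ 2 := by
          refine Finset.sum_le_sum fun k hk => ?_
          have hk' : k ≤ -(P.K : ℤ) := (Finset.mem_Icc.mp (by rw [hblk] at hk; exact hk)).2
          have hkR : (k : ℝ) ≤ -(P.K : ℝ) := by exact_mod_cast hk'
          have hw : Real.exp (P.θV * ((k : ℝ) - -(P.K : ℝ))) ≤ 1 :=
            Real.exp_le_one_iff.mpr (mul_nonpos_of_nonneg_of_nonpos hθ (by linarith))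
          have hs0 : ∀ i, u₂ i k 0 ^ 2 ≤ rk ^ 2 := by
            intro i
            simp only [hu₂]
            rw [← sq_abs]
            exact pow_le_pow_left₀ (abs_nonneg _) (hkick i k (by rw [hblk] at hk; exact hk)) 2
          have hs : (u₂ 0 k 0 ^ 2 + u₂ 1 k 0 ^ 2) / 2 ≤ rk ^ 2 := by linarith [hs0 0, hs0 1]
          have hsn : 0 ≤ (u₂ 0 k 0 ^ 2 + u₂ 1 k 0 ^ 2) / 2 := by positivity
          exact (mul_le_of_le_one_left hsn hw).trans hs
      _ = blk.card * rk ^ 2 := by rw [Finset.sum_const, nsmul_eq_mul]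
      _ ≤ (P.D : ℝ) * rk ^ 2 := mul_le_mul_of_nonneg_right hcard (sq_nonneg _)
  -- piece 3: the reference start residual
  have hE₃ : coMovingEnergyOn blk P.θV (-(P.K : ℝ)) u₃ 0 ≤ EW := by
    simpa only [hu₃, hblk, hx] using hEW
  -- Minkowski twice, then the elementary square-root algebra
  have hm₁ := sqrt_coMovingEnergyOn_add_le blk P.θV (-(P.K : ℝ)) (u₁ + u₂) u₃ 0
  have hm₂ := sqrt_coMovingEnergyOn_add_le blk P.θV (-(P.K : ℝ)) u₁ u₂ 0
  have hs₁ : Real.sqrt (coMovingEnergyOn blk P.θV (-(P.K : ℝ)) u₁ 0) ≤ Real.sqrt (P.v n + (P.δ n / ωK) ^ 2) :=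
    Real.sqrt_le_sqrt hE₁
  have hs₂ : Real.sqrt (coMovingEnergyOn blk P.θV (-(P.K : ℝ)) u₂ 0) ≤ Real.sqrt P.D * rk := by
    refine (Real.sqrt_le_sqrt hE₂).trans ?_
    rw [Real.sqrt_mul (Nat.cast_nonneg _), Real.sqrt_sq hrk]
  have hs₃ : Real.sqrt (coMovingEnergyOn blk P.θV (-(P.K : ℝ)) u₃ 0) ≤ Real.sqrt EW := Real.sqrt_le_sqrt hE₃
  rw [hsplit]
  linarith

end Start

/-! ## The edge input by amplitudes: `TubeStepNear` from `A`, `M`, the core deviation `r`, `V₀` and `R_T` only -/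

section Amplitude

variable (P : TubeSchedule) {ε ε₀ τ κ₂ κ₂' : ℝ} {i₀ : Fin 2} {ustar : Fin 2 → ℤ → ℝ}
  {W₀ FW₀ BW₀ S₀ FS₀ BS₀ : Fin 2 → ℤ → ℝ} {W FW S FS : Fin 2 → ℤ → ℝ → ℝ}

/-- **THE NEAR-ZONE HOP, EDGE INPUT BY AMPLITUDES.** As `near_hop_of_pseudoFlows`, with the edge-input hypothesis
replaced by the core deviation bound `|(S − W)_{0,1−K}(t)| ≤ r ≤ A` on the hop interval and
`Ē := e^{θ_V(1−D+K)}·(1+ε)A²(A+M) + (1+ε)·r·(A² + M r)` in the budget.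
[cite: Tao2016AveragedNS, §4 (4.3), (4.8), §6.3–6.4 (statement shape); route TaoLadderRungTwoFlat, L8b-1 E1/E2 (`MirrorPulse.edgeInput_le`) ⇒ `HopTube.TubeStepNear` (LADDER §49.3, §49.5)] -/
theorem near_hop_of_pseudoFlows_amp
    (hW : PseudoFlowOnShift shiftSetFlat τ ε₀ (mirrorTable ε ε) 0 κ₂ W₀ FW₀ BW₀ W FW)
    (hS : PseudoFlowOnShift shiftSetFlat τ ε₀ (mirrorTable ε ε) 0 κ₂' S₀ FS₀ BS₀ S FS)
    (hε : 0 ≤ ε) (hε₀ : 0 ≤ ε₀) (hθ : 0 ≤ P.θV) (hDK : P.K + 1 ≤ P.D)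
    {τ₁ σ a A M μ r V₀ RT : ℝ} {n : ℕ} (hτ₁ : 0 < τ₁) (hτ₁τ : τ₁ ≤ τ) (hστ : σ * τ₁ = 1) (ha : 0 < a)
    (hMnn : 0 ≤ M)
    (hA : ∀ t ∈ Ioo 0 τ₁, ∀ i, ∀ m ∈ Finset.Icc (-(P.D : ℤ)) (1 - (P.K : ℤ)), |(S - W) i m t| ≤ A)
    (hM : ∀ t ∈ Ioo 0 τ₁, ∀ i, ∀ m ∈ Finset.Icc (-(P.D : ℤ)) (1 - (P.K : ℤ)), |W i m t| ≤ M)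
    (hr : ∀ t ∈ Ioo 0 τ₁, |(S - W) 0 (1 - (P.K : ℤ)) t| ≤ r) (hrA : r ≤ A)
    (hμ : 0 < μ)
    (hμle : μ ≤ σ * P.θV - 2 * (1 + ε) * 1 * (A * Real.sinh (P.θV / 2) + M * (3 + Real.exp P.θV)))
    (hV₀ : coMovingEnergyOn (Finset.Icc (1 - (P.D : ℤ)) (-(P.K : ℤ))) P.θV (-(P.K : ℝ)) (S - W) 0 ≤ V₀)
    (hR : ∑ k ∈ Finset.Icc (-(P.D : ℤ)) (-(P.K : ℤ) - 1), Real.exp (P.θV * ((k : ℝ) + P.K)) *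
        ∑ i : Fin 2, (W i (1 + k) τ₁ - |S i₀ 1 τ₁| / P.Astar * ustar i k) ^ 2 / 2 ≤ RT)
    (hbudget : (Real.sqrt (Real.exp (-μ * τ₁) * V₀ +
        (Real.exp (P.θV * ((1 : ℝ) - P.D + P.K)) * ((1 + ε) * 1 * A ^ 2 * (A + M)) + (1 + ε) * 1 * r * (A ^ 2 + M * r))
          * (1 - Real.exp (-μ * τ₁)) / μ) + Real.sqrt RT) ^ 2 ≤ a ^ 2 * P.v (n + 1)) :
    NearClause P i₀ ustar (n + 1) (recentre S τ₁ a) := by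
  have hσ : 0 ≤ σ := by
    have : σ = 1 / τ₁ := by field_simp; linarith
    rw [this]; positivity
  refine near_hop_of_pseudoFlows P hW hS hε hε₀ hθ hDK hτ₁ hτ₁τ hστ ha hA hM ?_ hμ hμle hV₀ hR hbudget
  intro t ht
  have hσt : 0 ≤ σ * t := mul_nonneg hσ ht.1.le
  -- the four boundary amplitudes and the core deviation above the block
  have hqa : |(S - W) 1 (1 - (P.D : ℤ) - 1) t| ≤ A := hA t ht 1 _ (by simp only [Finset.mem_Icc]; omega)
  have hpa : |(S - W) 0 (1 - (P.D : ℤ)) t| ≤ A := hA t ht 0 _ (by simp only [Finset.mem_Icc]; omega)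
  have hqP : |(S - W) 1 (-(P.K : ℤ)) t| ≤ A := hA t ht 1 _ (by simp only [Finset.mem_Icc]; omega)
  have hr' : |(S - W) 0 (-(P.K : ℤ) + 1) t| ≤ r := by
    have e : (-(P.K : ℤ) + 1) = 1 - (P.K : ℤ) := by ring
    rw [e]; exact hr t ht
  have hPne : (((-(P.K : ℤ)) : ℤ) : ℝ) ≤ -(P.K : ℝ) + σ * t := by push_cast; linarith
  have hca : clock ε₀ (1 - (P.D : ℤ) - 1) ≤ 1 := clock_le_one_of_nonpos hε₀ (by omega)
  have hcP : clock ε₀ (-(P.K : ℤ)) ≤ 1 := clock_le_one_of_nonpos hε₀ (by omega)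
  have hedge := edgeInput_le (θ := P.θV) (ne := -(P.K : ℝ) + σ * t) hε (by linarith) hθ hMnn (S - W) t hPne
    hqa hpa hqP hr' hrA hca hcP
  refine hedge.trans ?_
  -- the bottom weight is at most its value at `t = 0`
  have hA0 : 0 ≤ A := le_trans ((abs_nonneg _).trans (hr t ht)) hrA
  have hX : 0 ≤ (1 + ε) * 1 * A ^ 2 * (A + M) := by positivity
  have hw : Real.exp (P.θV * ((((1 - (P.D : ℤ)) : ℤ) : ℝ) - (-(P.K : ℝ) + σ * t)))
      ≤ Real.exp (P.θV * ((1 : ℝ) - P.D + P.K)) := by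
    rw [Real.exp_le_exp]
    push_cast
    nlinarith
  nlinarith [mul_le_mul_of_nonneg_right hw hX]

end Amplitude

end Summit.NavierStokesRegularity.NavierStokesRegularity.Theorems.HopTube

end
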